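import Literature.Computability.Complexity.PaulPippengerSzemerediTrotter1983Shapes
import HarnessLib

/-!
# The one-counter automaton validating `y₁` (PPST 1983, §3 — the verifier, part 1)

Literature / complexity toolkit, twenty-third brick of the inline formalization of
Paul–Pippenger–Szemerédi–Trotter 1983 (`PaulPippengerSzemerediTrotter1983.lean`, fact
`PaulEtAl1983_NTIME_not_subset_DTIME`; roadmap Layer 4, machines, part 4). The first phase of
the linear-time verifier decides whether `y₁` decodes (`decY1`, `…Formats.lean`) and counts its
records. By `…Shapes.lean` this is the shape "a field, then records of `R = 9K + 2` fields to the
end"; here is the deterministic ONE-COUNTER AUTOMATON over tokens doing it online — state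
`(hdr, fresh, st, cnt, err)`: still in the header field / no token of the current record read /
fields completed in the current record / records completed / error —, exactly as the stack
program of the next brick runs it (including what the counter holds after an error), and the
proof that its clean final states are exactly decodability, with the record count:

* `A1St`, `a1step R`, `a1run R`, `a1run_cons`, `a1run_append`, `a1run_err` (errors absorb);
* `restCount` (what the record phase computes), `countRecs_fuel`, `restCount_bit/sep/…`;
* **`a1run_recs_iff`** (the record phase), **`a1run_iff`** (from the initial state the run on
  `ts` is clean with count `c` iff `skipField ts = some ts₁ ∧ countRecs R |ts₁| ts₁ = some c`);
* **`decY1_ne_none_iff_a1`** (with `…Shapes.lean`).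

No named fact is introduced (definitions with bodies and theorems only).

## References

* W. J. Paul, N. Pippenger, E. Szemerédi, W. T. Trotter, *On determinism versus non-determinism
  and related problems*, FOCS 1983, 429–438, §3 [PaulEtAl1983].
-/

namespace Literature.Computability.Complexity

open Function

namespace PPSTSpec

/-! ### The automaton -/

/-- States: in the header field; no token of the current record read yet; fields completed in
the current record (after an error: what the counter holds); records completed; error.
[folklore] -/
@[ext] structure A1St where
  /-- still inside the header field -/
  hdr : Bool
  /-- no token of the current record read yet -/
  fresh : Bool
  /-- fields completed in the current record -/
  st : ℕ
  /-- records completed -/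
  cnt : ℕ
  /-- error seen -/
  err : Bool
  deriving DecidableEq, Inhabited

/-- **One token** (records of `R` fields). [folklore] -/
def a1step (R : ℕ) (s : A1St) : Tok → A1St
  | .bit _ => if s.hdr then s else
      if s.st < R then { s with fresh := false } else { s with fresh := false, err := true }
  | .sep => if s.hdr then { s with hdr := false, fresh := true } else
      if s.st < R then { s with fresh := false, st := s.st + 1 } else { s with fresh := false, err := true }
  | .stop => if s.hdr then { s with err := true } else
      if s.st = R then { s with fresh := true, st := 0, cnt := s.cnt + 1 }
      else { s with fresh := false, st := s.st - (R + 1), err := true }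

/-- **The run** on a token stream. [folklore] -/
def a1run (R : ℕ) (s : A1St) (ts : List Tok) : A1St := ts.foldl (a1step R) s

/-- One token then the rest. [folklore] -/
theorem a1run_cons (R : ℕ) (s : A1St) (t : Tok) (ts : List Tok) :
    a1run R s (t :: ts) = a1run R (a1step R s t) ts := rfl

/-- The empty run. [folklore] -/
@[simp] theorem a1run_nil (R : ℕ) (s : A1St) : a1run R s [] = s := rfl

/-- Runs compose. [folklore] -/
theorem a1run_append (R : ℕ) (s : A1St) (ts ts' : List Tok) :
    a1run R s (ts ++ ts') = a1run R (a1run R s ts) ts' := List.foldl_append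

/-- A step never clears the error. [folklore] -/
theorem a1step_err (R : ℕ) (s : A1St) (t : Tok) (h : s.err = true) : (a1step R s t).err = true := by
  cases t <;> simp only [a1step] <;> split_ifs <;> simp [h]

/-- **Errors are absorbing.** [folklore] -/
theorem a1run_err (R : ℕ) : ∀ (ts : List Tok) (s : A1St), s.err = true → (a1run R s ts).err = true
  | [], _, h => h
  | t :: ts, s, h => a1run_err R ts _ (a1step_err R s t h)

/-! ### Lengths under skipping -/

/-- Skipping a field shortens. [folklore] -/
theorem length_skipField_lt : ∀ {ts ts' : List Tok}, skipField ts = some ts' → ts'.length < ts.length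
  | .bit _ :: ts, ts', h => by
    simp only [skipField] at h
    have := length_skipField_lt h; simp; omega
  | .sep :: ts, ts', h => by simp only [skipField, Option.some.injEq] at h; subst h; simp
  | .stop :: _, _, h => by simp [skipField] at h
  | [], _, h => by simp [skipField] at h

/-- Skipping fields does not lengthen. [folklore] -/
theorem length_skipFields_le : ∀ (n : ℕ) {ts ts' : List Tok}, skipFields n ts = some ts' → ts'.length ≤ ts.length
  | 0, ts, ts', h => by simp [skipFields] at h; rw [h]
  | n + 1, ts, ts', h => by
    simp only [skipFields, Option.bind_eq_some_iff] at h
    obtain ⟨ts₁, h1, h2⟩ := h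
    exact (length_skipFields_le n h2).trans (length_skipField_lt h1).le

/-- Skipping a record shortens. [folklore] -/
theorem length_skipRec_lt {R : ℕ} {ts ts' : List Tok} (h : skipRec R ts = some ts') : ts'.length < ts.length := by
  simp only [skipRec, Option.bind_eq_some_iff] at h
  obtain ⟨ts₁, h1, h2⟩ := h
  split at h2
  · simp only [Option.some.injEq] at h2; subst h2
    have := length_skipFields_le R h1; simp at this; omega
  · simp at h2

/-- With enough fuel, `countRecs` does not depend on the fuel. [folklore] -/
theorem countRecs_fuel (R : ℕ) (f : ℕ) (ts : List Tok) (h : ts.length ≤ f) :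
    countRecs R f ts = countRecs R ts.length ts := by
  suffices H : ∀ (n : ℕ) (ts : List Tok), ts.length ≤ n → ∀ f, ts.length ≤ f →
      countRecs R f ts = countRecs R ts.length ts from H ts.length ts le_rfl f h
  intro n
  induction n with
  | zero =>
    intro ts hts f _
    have : ts = [] := List.eq_nil_of_length_eq_zero (Nat.le_zero.1 hts)
    subst this; cases f <;> rfl
  | succ n ih =>
    intro ts hts f hf
    cases ts with
    | nil => cases f <;> rfl
    | cons t ts₀ =>
      obtain ⟨f₀, rfl⟩ : ∃ f₀, f = f₀ + 1 := ⟨f - 1, by simp at hf; omega⟩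
      simp only [countRecs, List.length_cons]
      rcases hsk : skipRec R (t :: ts₀) with _ | ts'
      · rfl
      · simp only [Option.bind_some]
        have hlt := length_skipRec_lt hsk
        simp only [List.length_cons] at hlt hts hf
        rw [ih ts' (by omega) f₀ (by omega), ih ts' (by omega) ts₀.length (by omega)]

/-! ### The record phase -/

/-- What the record phase computes from `st` fields completed: skip the remaining `R - st`
fields, expect the end-of-record token, count the remaining records (plus this one). [folklore] -/
def restCount (R st : ℕ) (ts : List Tok) : Option ℕ :=
  (skipFields (R - st) ts).bind fun ts' =>
    match ts' with
    | .stop :: ts'' => (countRecs R ts''.length ts'').map (· + 1)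
    | _ => none

/-- A data bit inside a field. [folklore] -/
theorem restCount_bit {R st : ℕ} (h : st < R) (d : Bool) (ts : List Tok) :
    restCount R st (.bit d :: ts) = restCount R st ts := by
  unfold restCount
  obtain ⟨m, hm⟩ : ∃ m, R - st = m + 1 := ⟨R - st - 1, by omega⟩
  rw [hm]; rfl

/-- An end of field. [folklore] -/
theorem restCount_sep {R st : ℕ} (h : st < R) (ts : List Tok) :
    restCount R st (.sep :: ts) = restCount R (st + 1) ts := by
  unfold restCount
  obtain ⟨m, hm⟩ : ∃ m, R - st = m + 1 := ⟨R - st - 1, by omega⟩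
  rw [hm, show R - (st + 1) = m by omega]; rfl

/-- An end of record after all fields. [folklore] -/
theorem restCount_stop (R : ℕ) (ts : List Tok) :
    restCount R R (.stop :: ts) = (countRecs R ts.length ts).map (· + 1) := by
  unfold restCount; simp [skipFields]

/-- A premature end of record. [folklore] -/
theorem restCount_stop_of_lt {R st : ℕ} (h : st < R) (ts : List Tok) : restCount R st (.stop :: ts) = none := by
  unfold restCount
  obtain ⟨m, hm⟩ : ∃ m, R - st = m + 1 := ⟨R - st - 1, by omega⟩
  rw [hm]; rfl

/-- A token after all fields that is not the end of record. [folklore] -/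
theorem restCount_full_bit (R : ℕ) (d : Bool) (ts : List Tok) : restCount R R (.bit d :: ts) = none := by
  unfold restCount; simp [skipFields]

/-- A token after all fields that is not the end of record. [folklore] -/
theorem restCount_full_sep (R : ℕ) (ts : List Tok) : restCount R R (.sep :: ts) = none := by
  unfold restCount; simp [skipFields]

/-- No tokens left in the middle of a record. [folklore] -/
theorem restCount_nil (R st : ℕ) : restCount R st [] = none := by
  unfold restCount
  rcases Nat.eq_zero_or_pos (R - st) with h | h
  · rw [h]; rfl
  · obtain ⟨m, hm⟩ : ∃ m, R - st = m + 1 := ⟨R - st - 1, by omega⟩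
    rw [hm]; rfl

/-- A nonempty stream at a record boundary counts as `restCount … 0`. [folklore] -/
theorem countRecs_eq_restCount (R : ℕ) (t : Tok) (ts : List Tok) :
    countRecs R (t :: ts).length (t :: ts) = restCount R 0 (t :: ts) := by
  simp only [List.length_cons, countRecs, restCount, Nat.sub_zero, skipRec, Option.bind_assoc]
  rcases h : skipFields R (t :: ts) with _ | ts'
  · rfl
  · simp only [Option.bind_some]
    have hle := length_skipFields_le R h
    rcases ts' with _ | ⟨_ | _ | _, ts''⟩
    · rfl
    · rfl
    · rfl
    · simp only [Option.bind_some]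
      simp only [List.length_cons] at hle
      rw [countRecs_fuel R ts.length ts'' (by omega)]

/-- **The record phase.** From a clean record-phase state (`st ≤ R`, `fresh → st = 0`) the run on
`ts` ends in the clean boundary state with count `cnt'` iff the stream parses: at a boundary
(`fresh`) as `countRecs`, inside a record as `restCount`. [folklore] -/
theorem a1run_recs_iff (R : ℕ) (hR : 1 ≤ R) : ∀ (ts : List Tok) (fresh : Bool) (st cnt cnt' : ℕ),
    st ≤ R → (fresh = true → st = 0) →
    (a1run R ⟨false, fresh, st, cnt, false⟩ ts = ⟨false, true, 0, cnt', false⟩ ↔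
      ∃ c, (if fresh then countRecs R ts.length ts else restCount R st ts) = some c ∧ cnt' = cnt + c)
  | [], fresh, st, cnt, cnt', hst, hfr => by
    cases fresh
    · simp [restCount_nil]
    · have := hfr rfl; subst this
      simp only [a1run_nil, A1St.mk.injEq, true_and, and_true, ↓reduceIte, List.length_nil, countRecs]
      constructor
      · rintro rfl; exact ⟨0, rfl, rfl⟩
      · rintro ⟨c, hc, rfl⟩; simp only [Option.some.injEq] at hc; omega
  | .bit d :: ts, fresh, st, cnt, cnt', hst, hfr => by
    rw [a1run_cons]
    have key : (if fresh then countRecs R (Tok.bit d :: ts).length (.bit d :: ts) else restCount R st (.bit d :: ts)) =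
        restCount R st (.bit d :: ts) := by
      cases fresh
      · rfl
      · rw [if_pos rfl, hfr rfl]; exact countRecs_eq_restCount R _ ts
    rw [key]
    simp only [a1step, Bool.false_eq_true, ↓reduceIte]
    by_cases hlt : st < R
    · rw [if_pos hlt, restCount_bit hlt]
      exact (a1run_recs_iff R hR ts false st cnt cnt' hst (by simp)).trans (by simp)
    · have hstR : st = R := by omega
      rw [if_neg hlt, hstR, restCount_full_bit]
      have herr := a1run_err R ts ⟨false, false, R, cnt, true⟩ rfl
      constructor
      · intro h; rw [h] at herr; simp at herr
      · rintro ⟨c, hc, _⟩; simp at hc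
  | .sep :: ts, fresh, st, cnt, cnt', hst, hfr => by
    rw [a1run_cons]
    have key : (if fresh then countRecs R (Tok.sep :: ts).length (.sep :: ts) else restCount R st (.sep :: ts)) =
        restCount R st (.sep :: ts) := by
      cases fresh
      · rfl
      · rw [if_pos rfl, hfr rfl]; exact countRecs_eq_restCount R _ ts
    rw [key]
    simp only [a1step, Bool.false_eq_true, ↓reduceIte]
    by_cases hlt : st < R
    · rw [if_pos hlt, restCount_sep hlt]
      exact (a1run_recs_iff R hR ts false (st + 1) cnt cnt' (by omega) (by simp)).trans (by simp)
    · have hstR : st = R := by omega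
      rw [if_neg hlt, hstR, restCount_full_sep]
      have herr := a1run_err R ts ⟨false, false, R, cnt, true⟩ rfl
      constructor
      · intro h; rw [h] at herr; simp at herr
      · rintro ⟨c, hc, _⟩; simp at hc
  | .stop :: ts, fresh, st, cnt, cnt', hst, hfr => by
    rw [a1run_cons]
    have key : (if fresh then countRecs R (Tok.stop :: ts).length (.stop :: ts) else restCount R st (.stop :: ts)) =
        restCount R st (.stop :: ts) := by
      cases fresh
      · rfl
      · rw [if_pos rfl, hfr rfl]; exact countRecs_eq_restCount R _ ts
    rw [key]
    simp only [a1step, Bool.false_eq_true, ↓reduceIte]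
    by_cases heq : st = R
    · rw [if_pos heq, heq, restCount_stop]
      refine (a1run_recs_iff R hR ts true 0 (cnt + 1) cnt' (Nat.zero_le _) (fun _ => rfl)).trans ?_
      simp only [↓reduceIte]
      constructor
      · rintro ⟨c, hc, rfl⟩; exact ⟨c + 1, by rw [hc]; rfl, by omega⟩
      · rintro ⟨c, hc, rfl⟩
        rcases hcr : countRecs R ts.length ts with _ | c'
        · rw [hcr] at hc; simp at hc
        · rw [hcr] at hc; simp only [Option.map_some, Option.some.injEq] at hc
          exact ⟨c', rfl, by omega⟩
    · have hlt : st < R := by omega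
      rw [if_neg heq, restCount_stop_of_lt hlt]
      have herr := a1run_err R ts ⟨false, false, st - (R + 1), cnt, true⟩ rfl
      constructor
      · intro h; rw [h] at herr; simp at herr
      · rintro ⟨c, hc, _⟩; simp at hc

/-! ### The whole run -/

/-- **The header phase is `skipField`, then the record phase.** From the initial state
`(true, true, 0, 0, false)`, the run on `ts` ends in the clean boundary state with count `c` iff
`skipField ts = some ts₁` and `countRecs R |ts₁| ts₁ = some c`. [folklore] -/
theorem a1run_iff (R : ℕ) (hR : 1 ≤ R) : ∀ (ts : List Tok) (c : ℕ),
    a1run R ⟨true, true, 0, 0, false⟩ ts = ⟨false, true, 0, c, false⟩ ↔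
      ∃ ts₁, skipField ts = some ts₁ ∧ countRecs R ts₁.length ts₁ = some c
  | [], c => by simp [skipField]
  | .bit d :: ts, c => by
    rw [a1run_cons]; simp only [a1step, ↓reduceIte, skipField]
    exact a1run_iff R hR ts c
  | .sep :: ts, c => by
    rw [a1run_cons]; simp only [a1step, ↓reduceIte, skipField, Option.some.injEq, exists_eq_left']
    have := a1run_recs_iff R hR ts true 0 0 c (Nat.zero_le _) (fun _ => rfl)
    simp only [↓reduceIte, Nat.zero_add, exists_eq_right'] at this
    exact this
  | .stop :: ts, c => by
    rw [a1run_cons]; simp only [a1step, ↓reduceIte, skipField]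
    have herr := a1run_err R ts ⟨true, true, 0, 0, true⟩ rfl
    constructor
    · intro h; rw [h] at herr; simp at herr
    · rintro ⟨ts₁, h, _⟩; simp at h

/-- **Decodability of `y₁` is the automaton's clean acceptance with a positive count.**
[folklore] -/
theorem decY1_ne_none_iff_a1 (K : ℕ) (y : List Bool) :
    decY1 K y ≠ none ↔ ∃ ts, toks y = some ts ∧ ∃ c, 1 ≤ c ∧
      a1run (9 * K + 2) ⟨true, true, 0, 0, false⟩ ts = ⟨false, true, 0, c, false⟩ := by
  rw [decY1_isSome_iff]
  refine exists_congr fun ts => and_congr_right fun _ => ?_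
  constructor
  · rintro ⟨ts₁, h1, c, h2, hc⟩
    exact ⟨c, hc, (a1run_iff _ (by omega) ts c).2 ⟨ts₁, h1, h2⟩⟩
  · rintro ⟨c, hc, h⟩
    obtain ⟨ts₁, h1, h2⟩ := (a1run_iff _ (by omega) ts c).1 h
    exact ⟨ts₁, h1, c, h2, hc⟩

/-- The automaton's count of a decoded `y₁` is its number of records. [folklore] -/
theorem a1_count_eq_length {K : ℕ} {y : List Bool} {D : Y1 K} (h : decY1 K y = some D) :
    ∃ ts, toks y = some ts ∧
      a1run (9 * K + 2) ⟨true, true, 0, 0, false⟩ ts = ⟨false, true, 0, D.recs.length, false⟩ := by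
  obtain ⟨ts, hts, ts₁, h1, h2⟩ := recs_length_of_decY1 h
  exact ⟨ts, hts, (a1run_iff _ (by omega) ts _).2 ⟨ts₁, h1, h2⟩⟩

end PPSTSpec

end Literature.Computability.Complexity
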